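import Summits.AtomisticToContinuum.BoseEinsteinCondensation.Theses.BECParticleIncrement

/-!
# Birth skeleton — piece `BootstrapStep` (stmt-AtomisticToContinuum-12321) of the split of `IncrementBound`

Route `BECParticleIncrement`, BC2-redirect of the deciding crux `IncrementBound` (stmt-12320). This file is
the BC3 skeleton of the piece `BootstrapStep` — the BULK-REGIME inductive step (`g₀L < (M+1)a`,
`M + 1 ≤ ρ₁L³`): given the induction hypothesis (`λ_max(γ_{M'}) ≥ M'/2` for `M' ≤ M`, increments `≥ 1/2`
below `M`) and the static-response inequality with constant `C` at every `M' ≤ M + 1`, one added particle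
raises the condensate number by at least `1/2`.

The cut is the TRANSFER ONTO A FIXED ONE-BODY PROJECTOR. `condensateNumber v (M+1) L` is an infimum over
near-minimisers of the SUPREMUM `λ_max(γ_Ψ) = sup_φ ⟨φ, γ_Ψ φ⟩` — nonlinear in the state. The line replaces
it by the occupation `⟨φ, γ_Ψ φ⟩` of ONE mode `φ`, a ROBUST NEAR-TOP MODE OF THE BATH (the `M`-particle
problem in the same box), which is LINEAR in `γ_Ψ` and therefore accessible to Hellmann–Feynman /
impurity perturbation theory in the coupling of the added particle (`H_{M+1} = H_M − Δ_y + ∑ⱼ v(xⱼ − y)`;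
the bosonic ground state is the ground state of the tagged problem by positivity, and `γ_{M+1}/(M+1)` is
the tagged particle's reduced density matrix):

* `stub_robustTopMode` (M/L-sized; fixed-box spectral theory) — in the dilute range of a large box, for
  every `θ > 0` the bath has a normalised mode `φ` that captures `condensateNumber v M L` up to `θ` on ALL
  `δ`-near-minimisers for some `δ > 0` (compactness of near-minimising sequences of the Dirichlet problem,
  uniqueness of the ground state on the connected dilute hard-core configuration domain, `L²`-continuity of
  occupations `|⟨φ,γ_Ψφ⟩ − ⟨φ,γ_Φφ⟩| ≤ 2M‖Ψ − Φ‖`). Fails for a degenerate ground space (hard SHELLS: an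
  admissible `v = ⊤·1_S` can disconnect the configuration domain) — then `condensateNumber` is an infimum
  over ground states and no single `φ` is robust; the crux itself is then in danger (route why-might-fail).
* `stub_occupationTransfer` (XL/open, LOAD-BEARING) — the crux's conclusion strengthened to the fixed
  projector: under the bulk/dilute conditions, the induction hypothesis and the response inequality, there
  is `θ > 0` such that for EVERY `θ`-robust near-top mode `φ` of the bath, every near-minimiser `Ψ` of the
  `(M+1)`-problem has `⟨φ, γ_Ψ φ⟩ ≥ condensateNumber v M L + 1/2`. Why easier than the crux: a fixed
  projector `|φ⟩⟨φ|` summed over particles is a one-body observable, its ground-state expectation is a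
  derivative of a sourced ground-state energy (Hellmann–Feynman), and the route's response hypothesis is
  exactly a family of sourced ground-state energies. CAVEAT recorded for the lead (see the crux idea
  `bogoliubov-rate-induction`): by particle symmetry `⟨φ,γ_Ψφ⟩ = (M+1)·p` with ONE per-particle occupation
  `p`, so the informal "tagged residue `p ≥ 1 − C√(ρa³)`" of the route header is itself near-complete BEC of
  the `(M+1)`-state; the carried hypothesis `λ_max ≥ M'/2` cannot feed that mechanism, only the response
  hypothesis can — this stub is where that tension is decided.

`BootstrapStep_of : stub_robustTopMode → stub_occupationTransfer → BootstrapStep` (kernel-checked, no sorry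
outside the stubs): thread the constants (`ρ₁ := min`, `L₀ := max (max LT LR) 1`), get `θ` from the transfer,
a `θ`-robust `φ` from the bath, `δ` from the transfer, and close with the tree lemmas
`le_condensateNumber` (a uniform lower bound on `λ_max` over `δ`-near-minimisers bounds `condensateNumber`
from below) and `occupation_le_maxOccupation`. The readable predicates (`Body`, `IHFloor`, `IHInc`, `Resp`,
`IsMode`, `IsRobustTopMode`) are definitional abbreviations (`bootstrapStep_iff` is `Iff.rfl`).
-/

namespace Summit.AtomisticToContinuum.BoseEinsteinCondensation.Cruxes.IncrementBound.Birth.Bootstrap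

open MeasureTheory
open scoped ENNReal
open Literature.MathematicalPhysics.QuantumManyBody.BoseGas
open Summit.AtomisticToContinuum.BoseEinsteinCondensation.Theses.BECParticleIncrement

noncomputable section

/-! ### Vocabulary (definitional abbreviations of the crux text, over tree declarations) -/

/-- The static-response inequality at `(v, C, L, M, k)` (verbatim the inner formula of
`StaticResponseBound` / of `BootstrapStep`'s response hypothesis). -/
def Body (v : ℝ → ℝ≥0∞) (C L : ℝ) (M : ℕ) (k : EuclideanSpace ℝ (Fin 3)) : Prop :=
  ∃ t₀ : ℝ, 0 < t₀ ∧ ∀ t : ℝ, 0 < t → t ≤ t₀ → 2 * Literature.MathematicalPhysics.QuantumManyBody.BoseGas.groundStateEnergy v M L + ENNReal.ofReal (2 * t * (M : ℝ)) ≤ (⨅ Ψ : Literature.MathematicalPhysics.QuantumManyBody.BoseGas.TrialState M L, (Literature.MathematicalPhysics.QuantumManyBody.BoseGas.energy v Ψ + ∫⁻ X, (∑ j : Fin M, ENNReal.ofReal (t * (1 + Real.cos (∑ i : Fin 3, k i * X j i)))) * (‖Ψ.ψ X‖₊ : ENNReal) ^ 2)) + (⨅ Ψ : Literature.MathematicalPhysics.QuantumManyBody.BoseGas.TrialState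 M L, (Literature.MathematicalPhysics.QuantumManyBody.BoseGas.energy v Ψ + ∫⁻ X, (∑ j : Fin M, ENNReal.ofReal (t * (1 - Real.cos (∑ i : Fin 3, k i * X j i)))) * (‖Ψ.ψ X‖₊ : ENNReal) ^ 2)) + ENNReal.ofReal (C * t ^ 2 * (M : ℝ) / (‖k‖ ^ 2 + (M : ℝ) / L ^ 3 * (Literature.MathematicalPhysics.QuantumManyBody.BoseGas.scatteringLength v).toReal))

/-- Induction hypothesis, telescoped form: `M'/2 ≤ λ_max(γ_{M'})` for `M' ≤ M`. -/
def IHFloor (v : ℝ → ℝ≥0∞) (L : ℝ) (M : ℕ) : Prop :=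
  ∀ M' : ℕ, M' ≤ M → ENNReal.ofReal ((M' : ℝ) / 2) ≤ condensateNumber v M' L

/-- Induction hypothesis: the increments below `M`. -/
def IHInc (v : ℝ → ℝ≥0∞) (L : ℝ) (M : ℕ) : Prop :=
  ∀ M' : ℕ, M' < M → condensateNumber v M' L + 2⁻¹ ≤ condensateNumber v (M' + 1) L

/-- Response hypothesis: the static-response inequality with constant `C` at every `M' ≤ M + 1`, `k ≠ 0`. -/
def Resp (v : ℝ → ℝ≥0∞) (C L : ℝ) (M : ℕ) : Prop :=
  ∀ M' : ℕ, M' ≤ M + 1 → ∀ k : EuclideanSpace ℝ (Fin 3), k ≠ 0 → Body v C L M' k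

/-- A normalised measurable one-particle mode (the index set of `maxOccupation`). -/
def IsMode (φ : Space → ℂ) : Prop :=
  AEStronglyMeasurable φ volume ∧ ∫⁻ x, (‖φ x‖₊ : ℝ≥0∞) ^ 2 = 1

/-- `φ` is a `θ`-ROBUST NEAR-TOP MODE of the `M`-particle problem in the box of side `L`: it is a mode, and
for some energy slack `δ > 0` every `δ`-near-minimiser `Ψ` occupies it up to `θ` as much as the ground
state condenses, `condensateNumber v M L ≤ ⟨φ, γ_Ψ φ⟩ + θ`. -/
def IsRobustTopMode (v : ℝ → ℝ≥0∞) (M : ℕ) (L : ℝ) (θ : ℝ≥0∞) (φ : Space → ℂ) : Prop :=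
  IsMode φ ∧ ∃ δ : ℝ≥0∞, 0 < δ ∧ ∀ Ψ : TrialState M L,
    energy v Ψ ≤ groundStateEnergy v M L + δ → condensateNumber v M L ≤ occupation M φ Ψ.ψ + θ

/-- `BootstrapStep` is, definitionally, its text over the abbreviations above. -/
theorem bootstrapStep_iff :
    BootstrapStep ↔ ∀ v : ℝ → ℝ≥0∞, IsRepulsiveFiniteRange v → ∀ C : ℝ, ∃ g₀ ρ₁ L₀ : ℝ, 0 < ρ₁ ∧
      ∀ L : ℝ, L₀ ≤ L → ∀ M : ℕ, g₀ * L < ((M : ℝ) + 1) * (scatteringLength v).toReal →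
        (M : ℝ) + 1 ≤ ρ₁ * L ^ 3 → IHFloor v L M → IHInc v L M → Resp v C L M →
          condensateNumber v M L + 2⁻¹ ≤ condensateNumber v (M + 1) L :=
  Iff.rfl

/-! ### Registered stubs -/

/-- **Stub (robust top mode of the bath; M/L-sized, fixed-box spectral theory).** In the dilute range of a
large Dirichlet box, for every `θ > 0` the `M`-particle problem has a `θ`-robust near-top mode.
[LSSY2005 §1.2 (γ, λ_max via near-minimisers); Reed–Simon IV XIII.12/XIII.47 (uniqueness, compactness)] -/
theorem stub_robustTopMode :
    ∀ v : ℝ → ℝ≥0∞, IsRepulsiveFiniteRange v → ∃ ρ₁ L₀ : ℝ, 0 < ρ₁ ∧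
      ∀ L : ℝ, L₀ ≤ L → ∀ M : ℕ, (M : ℝ) + 1 ≤ ρ₁ * L ^ 3 →
        ∀ θ : ℝ≥0∞, 0 < θ → ∃ φ : Space → ℂ, IsRobustTopMode v M L θ φ := by
  sorry

/-- **Stub (occupation transfer; XL/open, load-bearing).** The bulk-regime step ON A FIXED PROJECTOR: under
the bulk/dilute conditions, the induction hypothesis and the response inequality with constant `C`, there
is `θ > 0` such that for every `θ`-robust near-top mode `φ` of the bath, every near-minimiser of the
`(M+1)`-problem occupies `φ` at least `condensateNumber v M L + 1/2`.
[MysliwySeiringer2020, LampartTriay2025, arXiv:1909.02430, Stringari1995, GuentherEtAl2021] -/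
theorem stub_occupationTransfer :
    ∀ v : ℝ → ℝ≥0∞, IsRepulsiveFiniteRange v → ∀ C : ℝ, ∃ g₀ ρ₁ L₀ : ℝ, 0 < ρ₁ ∧
      ∀ L : ℝ, L₀ ≤ L → ∀ M : ℕ, g₀ * L < ((M : ℝ) + 1) * (scatteringLength v).toReal →
        (M : ℝ) + 1 ≤ ρ₁ * L ^ 3 → IHFloor v L M → IHInc v L M → Resp v C L M →
          ∃ θ : ℝ≥0∞, 0 < θ ∧ ∀ φ : Space → ℂ, IsRobustTopMode v M L θ φ →
            ∃ δ : ℝ≥0∞, 0 < δ ∧ ∀ Ψ : TrialState (M + 1) L,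
              energy v Ψ ≤ groundStateEnergy v (M + 1) L + δ →
                condensateNumber v M L + 2⁻¹ ≤ occupation (M + 1) φ Ψ.ψ := by
  sorry

/-! ### Composition -/

/-- **Composition (kernel-checked).** Robust top mode of the bath + occupation transfer give the piece
`BootstrapStep` BY NAME: the occupation of the fixed mode bounds `λ_max` of every near-minimiser of the
`(M+1)`-problem from below (`occupation_le_maxOccupation`), uniformly at slack `δ`, hence bounds
`condensateNumber v (M+1) L` from below (`le_condensateNumber`). -/
theorem BootstrapStep_of
    (hRob : ∀ v : ℝ → ℝ≥0∞, IsRepulsiveFiniteRange v → ∃ ρ₁ L₀ : ℝ, 0 < ρ₁ ∧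
      ∀ L : ℝ, L₀ ≤ L → ∀ M : ℕ, (M : ℝ) + 1 ≤ ρ₁ * L ^ 3 →
        ∀ θ : ℝ≥0∞, 0 < θ → ∃ φ : Space → ℂ, IsRobustTopMode v M L θ φ)
    (hTr : ∀ v : ℝ → ℝ≥0∞, IsRepulsiveFiniteRange v → ∀ C : ℝ, ∃ g₀ ρ₁ L₀ : ℝ, 0 < ρ₁ ∧
      ∀ L : ℝ, L₀ ≤ L → ∀ M : ℕ, g₀ * L < ((M : ℝ) + 1) * (scatteringLength v).toReal →
        (M : ℝ) + 1 ≤ ρ₁ * L ^ 3 → IHFloor v L M → IHInc v L M → Resp v C L M →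
          ∃ θ : ℝ≥0∞, 0 < θ ∧ ∀ φ : Space → ℂ, IsRobustTopMode v M L θ φ →
            ∃ δ : ℝ≥0∞, 0 < δ ∧ ∀ Ψ : TrialState (M + 1) L,
              energy v Ψ ≤ groundStateEnergy v (M + 1) L + δ →
                condensateNumber v M L + 2⁻¹ ≤ occupation (M + 1) φ Ψ.ψ) :
    BootstrapStep := by
  rw [bootstrapStep_iff]
  intro v hv C
  obtain ⟨ρR, LR, hρR, hR⟩ := hRob v hv
  obtain ⟨g₀, ρT, LT, hρT, hT⟩ := hTr v hv C
  refine ⟨g₀, min ρT ρR, max (max LT LR) 1, lt_min hρT hρR, ?_⟩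
  intro L hL M hbulk hdil hFloor hInc hResp
  have hLT : LT ≤ L := le_trans (le_trans (le_max_left LT LR) (le_max_left _ _)) hL
  have hLR : LR ≤ L := le_trans (le_trans (le_max_right LT LR) (le_max_left _ _)) hL
  have hL0 : (0 : ℝ) ≤ L := le_trans (le_trans zero_le_one (le_max_right _ 1)) hL
  have hL3 : (0 : ℝ) ≤ L ^ 3 := pow_nonneg hL0 3
  have hdT : (M : ℝ) + 1 ≤ ρT * L ^ 3 :=
    le_trans hdil (mul_le_mul_of_nonneg_right (min_le_left _ _) hL3)
  have hdR : (M : ℝ) + 1 ≤ ρR * L ^ 3 :=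
    le_trans hdil (mul_le_mul_of_nonneg_right (min_le_right _ _) hL3)
  -- the transfer gives θ; the bath supplies a θ-robust near-top mode; the transfer gives δ and the bound
  obtain ⟨θ, hθ, hall⟩ := hT L hLT M hbulk hdT hFloor hInc hResp
  obtain ⟨φ, hφ⟩ := hR L hLR M hdR θ hθ
  obtain ⟨δ, hδ, hocc⟩ := hall φ hφ
  -- a uniform lower bound on λ_max over δ-near-minimisers bounds the condensate number from below
  exact le_condensateNumber v hδ
    (fun Ψ hΨ => le_trans (hocc Ψ hΨ) (occupation_le_maxOccupation Ψ.ψ hφ.1.1 hφ.1.2))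

/-- The piece, from the registered stubs. -/
theorem BootstrapStep_proof : BootstrapStep :=
  BootstrapStep_of stub_robustTopMode stub_occupationTransfer

end

end Summit.AtomisticToContinuum.BoseEinsteinCondensation.Cruxes.IncrementBound.Birth.Bootstrap
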